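/-
Copyright (c) 2026. All rights reserved.
Released under Apache 2.0 license as described in the file LICENSE.
Authors: abc-iut cell, seat abc-iut-L5-d1 (wave 3, gen 4).
-/
import Literature.IUT.LogThetaLattice.LocalLogShellsProofs
import Literature.IUT.LogVolume.WildCubicUnitLogUnit
import HarnessLib

/-!
# The `3`-adic logarithm over a field containing `ζ₃` with residue field `𝔽₃`: `log(𝒪^×) = 3·𝒪`, `ℐ = 𝒪`

Proof-only file (theorems, no definitions). Classical local analysis (Neukirch, *Algebraic Number
Theory*, Ch. II (5.5); Washington, *Introduction to Cyclotomic Fields*, Lemma 1.4), recorded because the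
abc-iut cell's instance of [IUTchIII] Thm. 3.11 over real completions needs ONE finite place at which
the log-shell `ℐ_v = (p_v^*)⁻¹ · log_v(𝒪_v^×)` of [IUTchIII] Rmk. 1.2.2 (i) is known EXACTLY at a
RAMIFIED place (Team R's `ζ₃`-instance, GAP-LEDGER row G-c312-14-1: "`∃ c₀ ≠ 0, ℐ_v = c₀ · 𝒪_v`").

Setting (that of `LocalLogShellsProofs`): `K` a nontrivially normed field and normed `ℚ_3`-algebra with
ultrametric norm, `ζ : K` with `ζ² + ζ + 1 = 0`, `λ := ζ - 1`, and the hypothesis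

  `hres : ∀ s : K, ‖s‖ ≤ 1 → ‖s ^ 3 - s‖ ≤ ‖ζ - 1‖`

("the residue field is `𝔽₃` and `λ` is a uniformizer": every integer is congruent to `0, 1, 2` modulo
`λ`; for the completion of `ℚ(ζ₃)` at `(λ)` this is Fermat's little theorem in `𝒪/λ = 𝔽₃`).
Then (`λ² = -3ζ`, `‖λ‖² = ‖3‖ = 3⁻¹`):

* `norm_pow_six_sub_one_le` — for every unit `w` (`‖w‖ = 1`): `‖w⁶ - 1‖ ≤ ‖9‖`. Proof: `w² = 1 + λu`
  with `u` integral (`hres` at `w`), and `(1 + λu)³ - 1 = λ³ · u(u-1)(u-2-λ)` (the three cube roots of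
  unity `1, ζ, ζ²`), where `u(u-1)(u-2-λ) = (u³-u) - 3u(u-1) - λu(u-1)` has norm `≤ ‖λ‖` (`hres` at `u`);
* `norm_unitLog_le_norm_three` — `‖log w‖ ≤ ‖3‖` for abc-iut-S1's `p`-adic logarithm `unitLog = log_3`
  (`log w = 6⁻¹ · L(w⁶)`, `‖6⁻¹‖ = 3`, `‖L(w⁶)‖ ≤ ‖1 - w⁶‖ ≤ 9⁻¹`);
* `logUnits_eq_closedBall_norm_three` — `log_3({‖w‖ = 1}) = {‖z‖ ≤ ‖3‖}` (`⊇` by successive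
  approximation, `exists_logSeries_eq`), i.e. `log(𝒪^×) = 3·𝒪`;
* `nonarchLogShell_three_subset_integers` / `nonarchLogShell_three_eq_integers` — for the ring of
  integers `𝒪 = {‖x‖ ≤ 1}` and any `logk` on `𝒪^×` agreeing with `unitLog`, abc-iut-L6-t3's log-shell
  `nonarchLogShell 𝒪 logk 3 = 3⁻¹ · log(𝒪^×)` IS `𝒪` (with `IntegersSubsetLogShell`, abc-iut-L3-t11).

The instance at the completion of `ℚ(ζ₃)` at `(ζ₃ - 1)` is `UnitLogZetaThreeCompletion.lean`.
No new definitions; nothing here is disputed mathematics; no side is taken on [IUTchIII] Cor. 3.12.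
-/

noncomputable section

namespace Literature.IUT.LogVolume

open Metric IsUltrametricDist Literature.IUT.LogThetaLattice Literature.NumberTheory.Transcendental

variable {K : Type*} [NontriviallyNormedField K] [instK : NormedAlgebra ℚ_[3] K] [instU : IsUltrametricDist K]
include instK instU

/-! ## 1. Norms of `3`, `9`, `6⁻¹`, `ζ`, `λ = ζ - 1` -/

omit instU in
/-- `‖3‖ = 3⁻¹` in a normed `ℚ_3`-algebra. [cite: NeukirchANT1999, Ch. II Prop. (5.5)] -/
theorem norm_three_eq : ‖(3 : K)‖ = (3 : ℝ)⁻¹ := by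
  have h : ‖((3 : ℕ) : K)‖ = ‖((3 : ℕ) : ℚ_[3])‖ := by
    rw [← map_natCast (algebraMap ℚ_[3] K) 3, norm_algebraMap']
  rw [Nat.cast_ofNat] at h
  rw [h, Padic.norm_p]
  norm_num

omit instU in
/-- `‖9‖ = 9⁻¹` in a normed `ℚ_3`-algebra. [cite: NeukirchANT1999, Ch. II Prop. (5.5)] -/
theorem norm_nine_eq : ‖(9 : K)‖ = (9 : ℝ)⁻¹ := by
  have : (9 : K) = 3 * 3 := by norm_num
  rw [this, norm_mul, norm_three_eq]
  norm_num

omit instU in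
/-- `‖6⁻¹‖ = 3` in a normed `ℚ_3`-algebra (`‖2‖ = 1`: abc-iut-w5-d172's `WildCubic.norm_two`).
[cite: NeukirchANT1999, Ch. II Prop. (5.5)] -/
theorem norm_inv_six_eq : ‖((6 : ℕ) : K)⁻¹‖ = 3 := by
  have : ((6 : ℕ) : K) = 2 * 3 := by norm_num
  rw [norm_inv, this, norm_mul, WildCubic.norm_two, norm_three_eq]
  norm_num

omit instK instU in
/-- A primitive cube root of unity is a unit: `ζ² + ζ + 1 = 0 → ‖ζ‖ = 1` (`ζ³ = 1`).
[cite: Washington1997, Lemma 1.4] -/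
theorem norm_eq_one_of_cube_root {ζ : K} (hζ : ζ ^ 2 + ζ + 1 = 0) : ‖ζ‖ = 1 := by
  have h3 : ζ ^ 3 = 1 := by linear_combination (ζ - 1) * hζ
  have h : ‖ζ‖ ^ 3 = 1 := by rw [← norm_pow, h3, norm_one]
  exact (pow_eq_one_iff_of_nonneg (norm_nonneg ζ) (by norm_num)).mp h

omit instK instU in
/-- `‖ζ - 1‖² = ‖3‖` (`(ζ-1)² = -3ζ`): `λ = ζ - 1` is a square root of `3` up to units.
[cite: Washington1997, Lemma 1.4] -/
theorem norm_zeta_sub_one_sq {ζ : K} (hζ : ζ ^ 2 + ζ + 1 = 0) : ‖ζ - 1‖ ^ 2 = ‖(3 : K)‖ := by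
  have h : (ζ - 1) ^ 2 = -3 * ζ := by linear_combination hζ
  rw [← norm_pow, h, norm_mul, norm_neg, norm_eq_one_of_cube_root hζ, mul_one]

omit instU in
/-- `‖ζ - 1‖ < 1`. [cite: Washington1997, Lemma 1.4] -/
theorem norm_zeta_sub_one_lt_one {ζ : K} (hζ : ζ ^ 2 + ζ + 1 = 0) : ‖ζ - 1‖ < 1 := by
  have h := norm_zeta_sub_one_sq hζ
  rw [norm_three_eq] at h
  nlinarith [norm_nonneg (ζ - 1)]

omit instU in
/-- `ζ - 1 ≠ 0`. [cite: Washington1997, Lemma 1.4] -/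
theorem zeta_sub_one_ne_zero {ζ : K} (hζ : ζ ^ 2 + ζ + 1 = 0) : ζ - 1 ≠ 0 := by
  intro h0
  have h := norm_zeta_sub_one_sq hζ
  rw [h0, norm_zero, norm_three_eq] at h
  norm_num at h

omit instU in
/-- `‖3‖ ≤ ‖ζ - 1‖` (`‖3‖ = ‖λ‖²`, `‖λ‖ ≤ 1`). [cite: Washington1997, Lemma 1.4] -/
theorem norm_three_le_norm_zeta_sub_one {ζ : K} (hζ : ζ ^ 2 + ζ + 1 = 0) : ‖(3 : K)‖ ≤ ‖ζ - 1‖ := by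
  rw [← norm_zeta_sub_one_sq hζ, sq]
  exact mul_le_of_le_one_left (norm_nonneg _) (norm_zeta_sub_one_lt_one hζ).le

/-! ## 2. Sixth powers of units are `≡ 1 (mod 9)` -/

/-- **Key congruence**: if every integer `s` satisfies `‖s³ - s‖ ≤ ‖ζ - 1‖` (residue field `𝔽₃`,
`ζ - 1` a uniformizer), then `‖w⁶ - 1‖ ≤ ‖9‖` for every unit `w`: `w² = 1 + λu`, and
`(1 + λu)³ - 1 = λ³ · u(u-1)(u-2-λ)` with `u(u-1)(u-2-λ) = (u³-u) - 3u(u-1) - λu(u-1) ≡ 0 (mod λ)`.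
[cite: Washington1997, Lemma 1.4] -/
theorem norm_pow_six_sub_one_le {ζ : K} (hζ : ζ ^ 2 + ζ + 1 = 0)
    (hres : ∀ s : K, ‖s‖ ≤ 1 → ‖s ^ 3 - s‖ ≤ ‖ζ - 1‖) {w : K} (hw : ‖w‖ = 1) :
    ‖w ^ 6 - 1‖ ≤ ‖(9 : K)‖ := by
  have hlam0 : ζ - 1 ≠ 0 := zeta_sub_one_ne_zero hζ
  have hlam1 : ‖ζ - 1‖ ≤ 1 := (norm_zeta_sub_one_lt_one hζ).le
  have hlampos : 0 < ‖ζ - 1‖ := norm_pos_iff.mpr hlam0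
  -- `w² - 1 = λ u` with `u` integral
  have h1 : ‖w ^ 2 - 1‖ ≤ ‖ζ - 1‖ := by
    have h := hres w hw.le
    have e : w ^ 3 - w = w * (w ^ 2 - 1) := by ring
    rwa [e, norm_mul, hw, one_mul] at h
  obtain ⟨u, hwu⟩ : ∃ u : K, w ^ 2 - 1 = (ζ - 1) * u :=
    ⟨(w ^ 2 - 1) / (ζ - 1), by field_simp⟩
  have hu : ‖u‖ ≤ 1 := by
    rw [hwu, norm_mul] at h1
    exact le_of_mul_le_mul_left (h1.trans_eq (mul_one _).symm) hlampos
  -- the cube: `y³ - 1 = (y - 1)(y - ζ)(y - ζ²)` at `y = w² = 1 + λu`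
  have key : w ^ 6 - 1 = (ζ - 1) ^ 3 * (u * (u - 1) * (u - 2 - (ζ - 1))) := by
    have e6 : w ^ 6 - 1 = (w ^ 2 - 1) * ((w ^ 2 - 1) ^ 2 + 3 * (w ^ 2 - 1) + 3) := by ring
    rw [e6, hwu]
    linear_combination (u ^ 2 * (ζ - 1) ^ 2 + u * (ζ - 1) * (2 - ζ)) * hζ
  have hfac : u * (u - 1) * (u - 2 - (ζ - 1)) =
      (u ^ 3 - u) + (-(3 * (u * (u - 1)))) + (-((ζ - 1) * (u * (u - 1)))) := by
    ring
  have hu1 : ‖u - 1‖ ≤ 1 := by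
    rw [sub_eq_add_neg]
    refine (norm_add_le_max u (-1)).trans (max_le hu ?_)
    rw [norm_neg, norm_one]
  have huu : ‖u * (u - 1)‖ ≤ 1 := by
    rw [norm_mul]
    exact mul_le_one₀ hu (norm_nonneg _) hu1
  have hA : ‖u ^ 3 - u‖ ≤ ‖ζ - 1‖ := hres u hu
  have hB : ‖-(3 * (u * (u - 1)))‖ ≤ ‖ζ - 1‖ := by
    rw [norm_neg, norm_mul]
    exact (mul_le_of_le_one_right (norm_nonneg _) huu).trans (norm_three_le_norm_zeta_sub_one hζ)
  have hC : ‖-((ζ - 1) * (u * (u - 1)))‖ ≤ ‖ζ - 1‖ := by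
    rw [norm_neg, norm_mul]
    exact mul_le_of_le_one_right (norm_nonneg _) huu
  have h3 : ‖u * (u - 1) * (u - 2 - (ζ - 1))‖ ≤ ‖ζ - 1‖ := by
    rw [hfac]
    exact (norm_add_le_max _ _).trans (max_le ((norm_add_le_max _ _).trans (max_le hA hB)) hC)
  calc ‖w ^ 6 - 1‖ = ‖ζ - 1‖ ^ 3 * ‖u * (u - 1) * (u - 2 - (ζ - 1))‖ := by
        rw [key, norm_mul, norm_pow]
    _ ≤ ‖ζ - 1‖ ^ 3 * ‖ζ - 1‖ := by gcongr
    _ = (‖ζ - 1‖ ^ 2) ^ 2 := by ring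
    _ = ‖(9 : K)‖ := by
        rw [norm_zeta_sub_one_sq hζ, ← norm_pow]
        norm_num

/-! ## 3. `‖log w‖ ≤ ‖3‖`, i.e. `log(𝒪^×) ⊆ 3·𝒪`; and `log(𝒪^×) = 3·𝒪` -/

/-- The sixth power of a unit is a principal unit (indeed `≡ 1 (mod 9)`).
[cite: NeukirchANT1999, Ch. II Prop. (5.5)] -/
theorem isPrincipal_pow_six {ζ : K} (hζ : ζ ^ 2 + ζ + 1 = 0)
    (hres : ∀ s : K, ‖s‖ ≤ 1 → ‖s ^ 3 - s‖ ≤ ‖ζ - 1‖) {w : K} (hw : ‖w‖ = 1) :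
    IsPrincipal (w ^ 6) := by
  rw [isPrincipal_iff, norm_sub_rev]
  refine (norm_pow_six_sub_one_le hζ hres hw).trans_lt ?_
  rw [norm_nine_eq]
  norm_num

/-- **`‖log_3 w‖ ≤ ‖3‖` for every unit `w`** (abc-iut-S1's `unitLog`): `log w = 6⁻¹ · L(w⁶)` with
`‖6⁻¹‖ = 3` and `‖L(w⁶)‖ ≤ ‖1 - w⁶‖ ≤ 9⁻¹` (Lipschitz bound of the logarithmic series on the ball of
radius `9⁻¹`, `9⁻¹ · 3^{1/2} ≤ 1`). So `log(𝒪^×) ⊆ 3 · 𝒪`. [cite: NeukirchANT1999, Ch. II Prop. (5.5)] -/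
theorem norm_unitLog_le_norm_three [CompleteSpace K] {ζ : K} (hζ : ζ ^ 2 + ζ + 1 = 0)
    (hres : ∀ s : K, ‖s‖ ≤ 1 → ‖s ^ 3 - s‖ ≤ ‖ζ - 1‖) {w : K} (hw : ‖w‖ = 1) :
    ‖unitLog w‖ ≤ ‖(3 : K)‖ := by
  have hP := isPrincipal_pow_six hζ hres hw
  rw [unitLog_eq_inv_mul_logSeries 3 (by norm_num : 0 < 6) hP, norm_mul, norm_inv_six_eq]
  have h9 : ‖1 - w ^ 6‖ ≤ ‖(9 : K)‖ := by
    rw [norm_sub_rev]; exact norm_pow_six_sub_one_le hζ hres hw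
  have hθ : ‖(9 : K)‖ * ((3 : ℕ) : ℝ) ^ (1 / (((3 : ℕ) : ℝ) - 1)) ≤ 1 := by
    rw [norm_nine_eq]
    have h : ((3 : ℕ) : ℝ) ^ (1 / (((3 : ℕ) : ℝ) - 1)) ≤ 3 := by
      have e : (1 / (((3 : ℕ) : ℝ) - 1)) = (1 / 2 : ℝ) := by norm_num
      rw [e, show ((3 : ℕ) : ℝ) = 3 by norm_num]
      calc (3 : ℝ) ^ (1 / 2 : ℝ) ≤ (3 : ℝ) ^ (1 : ℝ) :=
            Real.rpow_le_rpow_of_exponent_le (by norm_num) (by norm_num)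
        _ = 3 := Real.rpow_one 3
    calc (9 : ℝ)⁻¹ * ((3 : ℕ) : ℝ) ^ (1 / (((3 : ℕ) : ℝ) - 1)) ≤ (9 : ℝ)⁻¹ * 3 := by gcongr
      _ ≤ 1 := by norm_num
  have hL : ‖logSeries (w ^ 6)‖ ≤ ‖1 - w ^ 6‖ := norm_logSeries_le_norm 3 K hθ h9
  calc 3 * ‖logSeries (w ^ 6)‖ ≤ 3 * ‖(9 : K)‖ := by gcongr; exact hL.trans h9
    _ = ‖(3 : K)‖ := by rw [norm_nine_eq, norm_three_eq]; norm_num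

/-- **`log_3(𝒪^×) = 3 · 𝒪`**: abc-iut-S1's `logUnits K = log_3({‖w‖ = 1})` is the closed ball of radius
`‖3‖` (`⊆`: `norm_unitLog_le_norm_three`; `⊇`: every `z` with `‖z‖ ≤ 3⁻¹` is `L(y) = log y` for a
principal unit `y`, successive approximation with `3⁻¹ · 3^{1/2} < 1`).
[cite: NeukirchANT1999, Ch. II Prop. (5.5)] -/
theorem logUnits_eq_closedBall_norm_three [CompleteSpace K] {ζ : K} (hζ : ζ ^ 2 + ζ + 1 = 0)
    (hres : ∀ s : K, ‖s‖ ≤ 1 → ‖s ^ 3 - s‖ ≤ ‖ζ - 1‖) :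
    LogVolume.logUnits K = {z : K | ‖z‖ ≤ ‖(3 : K)‖} := by
  ext z
  rw [LogVolume.mem_logUnits_iff, Set.mem_setOf_eq]
  constructor
  · rintro ⟨w, hw, rfl⟩
    exact norm_unitLog_le_norm_three hζ hres hw
  · intro hz
    have hθ : ‖(3 : K)‖ * ((3 : ℕ) : ℝ) ^ (1 / (((3 : ℕ) : ℝ) - 1)) < 1 := by
      rw [norm_three_eq]
      have e : (1 / (((3 : ℕ) : ℝ) - 1)) = (1 / 2 : ℝ) := by norm_num
      rw [e, show ((3 : ℕ) : ℝ) = 3 by norm_num]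
      have h : (3 : ℝ) ^ (1 / 2 : ℝ) < 3 := by
        calc (3 : ℝ) ^ (1 / 2 : ℝ) < (3 : ℝ) ^ (1 : ℝ) :=
              Real.rpow_lt_rpow_of_exponent_lt (by norm_num) (by norm_num)
          _ = 3 := Real.rpow_one 3
      calc (3 : ℝ)⁻¹ * (3 : ℝ) ^ (1 / 2 : ℝ) < (3 : ℝ)⁻¹ * 3 := by gcongr
        _ = 1 := by norm_num
    obtain ⟨y, hy, hLy⟩ := exists_logSeries_eq 3 K hθ hz
    have hyP : IsPrincipal y := by
      rw [isPrincipal_iff]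
      exact hy.trans_lt (by rw [norm_three_eq]; norm_num)
    exact ⟨y, hyP.norm_eq_one, by rw [unitLog_of_isPrincipal 3 hyP, hLy]⟩

/-! ## 4. The log-shell `ℐ = 3⁻¹ · log(𝒪^×)` equals `𝒪` -/

variable (O : ValuationSubring K)

/-- **`ℐ ⊆ 𝒪`**: for the ring of integers `𝒪 = {‖x‖ ≤ 1}` and any logarithm `logk` on `𝒪^×` agreeing
with `unitLog = log_3`, abc-iut-L6-t3's log-shell `ℐ = (3^*)⁻¹ · log(𝒪^×)` (`3^* = 3`) is contained in
`𝒪` (`‖3⁻¹ · log w‖ = 3 · ‖log w‖ ≤ 1`). [cite: NeukirchANT1999, Ch. II Prop. (5.5)] -/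
theorem nonarchLogShell_three_subset_integers [CompleteSpace K] {ζ : K} (hζ : ζ ^ 2 + ζ + 1 = 0)
    (hres : ∀ s : K, ‖s‖ ≤ 1 → ‖s ^ 3 - s‖ ≤ ‖ζ - 1‖) (hO : ∀ x : K, x ∈ O ↔ ‖x‖ ≤ 1)
    (logk : Additive (↥O)ˣ →+ K)
    (hlog : ∀ u : (↥O)ˣ, logk (Additive.ofMul u) = unitLog ((u : ↥O) : K)) :
    nonarchLogShell O logk 3 ⊆ (O : Set K) := by
  rintro _ ⟨x, rfl⟩
  have h3 : pStar 3 = 3 := pStar_of_odd (by decide)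
  rw [SetLike.mem_coe, hO, hlog x, h3, Nat.cast_ofNat, norm_mul, norm_inv, norm_three_eq, inv_inv]
  have h := norm_unitLog_le_norm_three hζ hres (norm_coe_unit_of_iff_norm_le_one O hO x)
  rw [norm_three_eq] at h
  calc 3 * ‖unitLog ((x : ↥O) : K)‖ ≤ 3 * (3 : ℝ)⁻¹ := by gcongr
    _ = 1 := by norm_num

/-- **`ℐ = 𝒪`** ([IUTchIII] Rmk. 1.2.2 (i) at a field with residue field `𝔽₃` containing `ζ₃`): with
abc-iut-L3-t11's `IntegersSubsetLogShell` (`𝒪 ⊆ ℐ`, discharged for `unitLog`) the log-shell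
`3⁻¹ · log_3(𝒪^×)` is exactly the ring of integers. [cite: NeukirchANT1999, Ch. II Prop. (5.5)] -/
theorem nonarchLogShell_three_eq_integers [CompleteSpace K] {ζ : K} (hζ : ζ ^ 2 + ζ + 1 = 0)
    (hres : ∀ s : K, ‖s‖ ≤ 1 → ‖s ^ 3 - s‖ ≤ ‖ζ - 1‖) (hO : ∀ x : K, x ∈ O ↔ ‖x‖ ≤ 1)
    (logk : Additive (↥O)ˣ →+ K)
    (hlog : ∀ u : (↥O)ˣ, logk (Additive.ofMul u) = unitLog ((u : ↥O) : K)) :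
    nonarchLogShell O logk 3 = (O : Set K) :=
  Set.Subset.antisymm (nonarchLogShell_three_subset_integers O hζ hres hO logk hlog)
    (integersSubsetLogShell_of_eq_unitLog 3 O hO logk hlog).subset

end Literature.IUT.LogVolume

end
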